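import Literature.Barriers.PneNP.TSPExtensionComplexity
import Literature.Barriers.PneNP.TSPExtensionComplexityKaibelWeltge
import Literature.Barriers.PneNP.TSPExtensionComplexityRectangles
import Literature.Barriers.PneNP.TSPExtensionComplexityGadgetTours
import Mathlib.Analysis.Convex.Hull
import Mathlib.Analysis.SpecialFunctions.Pow.Real
import Mathlib.Analysis.SpecialFunctions.Sqrt
import HarnessLib

/-!
# Discharge of the barrier fact `TSPExtensionComplexity` (FMPTW 2015, Thm. 12)

`theorem TSPExtensionComplexity_holds : TSPExtensionComplexity` — "The extension complexity of
the TSP polytope `TSP(n)` is `2^{Ω(n^{1/2})}`" — sorry-free, assembling the sibling files: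

1. `HasEFOfSize.three_pow_le` — an EF of size `r` of a set carrying `2^n` points and `2^n` valid
   inequalities with the unique-disjointness slack pattern forces `3^n ≤ (r+1)·2^n`
   (`…Rectangles.lean`: duality-free Yannakakis covering; `…KaibelWeltge.lean`: `ϱ(n) ≤ 2^n`).
2. `three_pow_le_of_hasEF` — for `N = 15n² + 2n + pad` the TSP polytope `TSP(N)` carries such
   data: transport the complete graph on the gadget vertex type `GV n pad` to `Fin N`
   (`…Tours.lean`), take the `2^n` designated tours `T_b` (`…GadgetTours.lean`) as points and the
   counting functionals of `…GadgetIneq.lean` as inequalities (valid on every tour, hence on the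
   hull), whose value at `T_b` is `d_a - (|a ∩ b| - 1)²`.
3. Asymptotics: for `N ≥ 900`, `n := ⌊√N⌋ / 5` gives `15n² + 2n ≤ N` and `n ≥ √N/5 - 2`, so every
   EF of `TSP(N)` has size `r ≥ (3/2)^n - 1 ≥ (3/2)^{√N/10} = 2^{c√N}` with
   `c = log(3/2) / (10 log 2)`.

The only deviation from the printed proof is the graph in step 2 (our XOR-gadget graph instead
of FMPTW's Lemma 11 3SAT graph) and the duality-free covering lemma in step 1; the statement
proved is exactly the vendored `TSPExtensionComplexity`. Sources: [FioriniEtAl2015] Thms. 3, 4,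
7, Lemma 6, Lemma 11, Thm. 12 (PDF pp. 8–11); [KaibelWeltge2014] Thm. 1.
-/

noncomputable section

namespace Literature.Barriers.PneNP

open Finset Matrix Filter GV

/-! ### Step 1: EF size versus the unique-disjointness pattern -/

/-- **EF size versus the unique-disjointness pattern.** If `P` has an extended formulation of
size `r` and carries `2^n` points `v b ∈ P` and `2^n` valid inequalities `c a · x ≤ d a`
(`a, b ⊆ [n]`) whose slacks are positive on disjoint pairs and vanish whenever `|a ∩ b| = 1`,
then `3^n ≤ (r + 1) · 2^n` (FMPTW Thm. 7's mechanism with Kaibel–Weltge's count).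
[cite: FioriniEtAl2015, Thm. 7 (proof, PDF p. 9)] -/
theorem HasEFOfSize.three_pow_le {ι : Type} [Fintype ι] {r n : ℕ} {P : Set (ι → ℝ)}
    (h : HasEFOfSize P r) (v : Finset (Fin n) → ι → ℝ) (hv : ∀ b, v b ∈ P)
    (c : Finset (Fin n) → ι → ℝ) (d : Finset (Fin n) → ℝ)
    (hvalid : ∀ a, ∀ x ∈ P, c a ⬝ᵥ x ≤ d a)
    (hone : ∀ a b, c a ⬝ᵥ v b < d a → (a ∩ b).card ≠ 1)
    (hdisj : ∀ a b, Disjoint a b → c a ⬝ᵥ v b < d a) :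
    3 ^ n ≤ (r + 1) * 2 ^ n := by
  classical
  obtain ⟨RA, RB, hin, hcov⟩ := h.exists_cover_option v hv c d hvalid
  have key := three_pow_le_card_mul_two_pow_of_cover_univ (α := Fin n)
    (Finset.univ : Finset (Option (Fin r))) RA RB (fun j _ a ha b hb => hone a b (hin j a ha b hb))
    (fun a b hab => by
      obtain ⟨j, ha, hb⟩ := hcov a b (hdisj a b hab)
      exact ⟨j, Finset.mem_univ _, ha, hb⟩)
  simpa [Fintype.card_fin, Fintype.card_option] using key

/-! ### Step 2: the data on `TSP(15n² + 2n + pad)` -/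

section transport

variable {N : ℕ}

/-- A functional of the form `ε ↦ φ ε` evaluates on a characteristic vector as a sum over the
edge set. [folklore] -/
theorem dotProduct_charVec (φ : Sym2 (Fin N) → ℝ) (F : Finset (Sym2 (Fin N)))
    (hF : ∀ x ∈ F, x ∈ (⊤ : SimpleGraph (Fin N)).edgeSet) :
    (fun ε : (⊤ : SimpleGraph (Fin N)).edgeSet => φ ε) ⬝ᵥ charVec F = ∑ x ∈ F, φ x := by
  classical
  simp only [dotProduct, charVec, mul_ite, mul_one, mul_zero]
  rw [← Finset.sum_filter]
  have hfilter : (Finset.univ.filter fun ε : (⊤ : SimpleGraph (Fin N)).edgeSet =>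
      (ε : Sym2 (Fin N)) ∈ F) = F.subtype (· ∈ (⊤ : SimpleGraph (Fin N)).edgeSet) := by
    ext ε
    simp [Finset.mem_subtype]
  rw [hfilter, Finset.sum_subtype_eq_sum_filter, Finset.filter_true_of_mem hF]

/-- Tour edge sets consist of edges of the complete graph. [folklore] -/
theorem IsTourOn.mem_edgeSet {V : Type*} [DecidableEq V] {T : Finset (Sym2 V)} (hT : IsTourOn T)
    {e : Sym2 V} (he : e ∈ T) : e ∈ (⊤ : SimpleGraph V).edgeSet := by
  rw [SimpleGraph.edgeSet_top]
  exact hT.not_isDiag he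

end transport

section counting

variable {n pad : ℕ}

/-- Double counting: summing over `y ∈ T` the number of `x ∈ s` with `f x = y` counts the
`x ∈ s` with `f x ∈ T`. [folklore] -/
theorem sum_card_filter_eq {α β : Type*} [DecidableEq β] (s : Finset α) (T : Finset β)
    (f : α → β) :
    ∑ y ∈ T, ((s.filter fun x => f x = y).card : ℝ) = ((s.filter fun x => f x ∈ T).card : ℝ) := by
  classical
  rw [← Nat.cast_sum]
  congr 1
  simp only [Finset.card_filter]
  rw [Finset.sum_comm]
  refine Finset.sum_congr rfl fun x _ => ?_
  rw [Finset.sum_ite_eq]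

/-- The coefficient vector of the inequality of `a` on the edges of the complete graph on
`GV n pad`: `+1` per ordered pair `(i,j) ∈ a.offDiag` whose plain edge it is, `-1` per `i ∈ a`
whose chain edge it is, `-n²` if it is not an edge of the gadget graph.
[cite: FioriniEtAl2015, Lemma 6 (PDF p. 9)] -/
def coeff (a : Finset (Fin n)) (e : Sym2 (GV n pad)) : ℝ :=
  ((a.offDiag.filter fun p => rpe p = e).card : ℝ) - ((a.filter fun i => ge i = e).card : ℝ)
    - (n : ℝ) ^ 2 * (if e ∈ (gadgetGraph n pad).edgeSet then 0 else 1)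

/-- The right-hand side `|a.offDiag| - |a| + 1`. [cite: FioriniEtAl2015, Lemma 6 (PDF p. 9)] -/
def rhs (a : Finset (Fin n)) : ℝ := (a.offDiag.card : ℝ) - a.card + 1

/-- Summing the coefficients over an edge set gives the counting expression of
`…GadgetIneq.lean`. [folklore] -/
theorem sum_coeff (a : Finset (Fin n)) (T : Finset (Sym2 (GV n pad))) :
    ∑ e ∈ T, coeff a e =
      ((a.offDiag.filter fun p => rpe p ∈ T).card : ℝ) - ((a.filter fun i => ge i ∈ T).card : ℝ)
        - (n : ℝ) ^ 2 * ((T.filter fun e => e ∉ (gadgetGraph n pad).edgeSet).card : ℝ) := by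
  classical
  simp only [coeff, Finset.sum_sub_distrib, ← Finset.mul_sum]
  rw [sum_card_filter_eq, sum_card_filter_eq]
  congr 1
  rw [Finset.card_filter]
  push_cast
  simp only [ite_not]

/-- The counting expression is bounded by `rhs a` on every tour (cast of `tour_ineq`).
[cite: FioriniEtAl2015, Lemma 6 (PDF p. 9)] -/
theorem sum_coeff_le {T : Finset (Sym2 (GV n pad))} (hT : IsTourOn T) (a : Finset (Fin n)) :
    ∑ e ∈ T, coeff a e ≤ rhs a := by
  rw [sum_coeff, rhs]
  have := tour_ineq hT a
  exact_mod_cast this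

/-- The counting expression at the designated tour `T_b` equals `rhs a - (|a ∩ b| - 1)²`.
[cite: FioriniEtAl2015, Lemma 6 (PDF p. 9)] -/
theorem sum_coeff_tourEdges (hn : 0 < n) (a b : Finset (Fin n)) :
    ∑ e ∈ tourEdges pad b, coeff a e = rhs a - ((a ∩ b).card - 1 : ℝ) ^ 2 := by
  rw [sum_coeff, rhs]
  have := val_tourEdges (pad := pad) b hn a
  exact_mod_cast this

end counting

/-- **The unique-disjointness data on `TSP(15n² + 2n + pad)`.** Every extended formulation of
the TSP polytope on `N = |GV n pad|` cities has size `r` with `3^n ≤ (r + 1)·2^n`.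
[cite: FioriniEtAl2015, Thm. 7, Lemma 11 and Thm. 12 (PDF pp. 9–11)] -/
theorem three_pow_le_of_hasEF {n pad r : ℕ} (hn : 0 < n)
    (h : HasEFOfSize (tspPolytope (15 * n ^ 2 + 2 * n + pad)) r) : 3 ^ n ≤ (r + 1) * 2 ^ n := by
  classical
  set N := 15 * n ^ 2 + 2 * n + pad with hN
  -- the gadget vertex type has exactly `N` elements
  let eqv : GV n pad ≃ Fin N := Fintype.equivFinOfCardEq (GV.card n pad)
  -- the data
  let c : Finset (Fin n) → (⊤ : SimpleGraph (Fin N)).edgeSet → ℝ :=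
    fun a ε => coeff a (Sym2.map eqv.symm (ε : Sym2 (Fin N)))
  let Tb : Finset (Fin n) → Finset (Sym2 (Fin N)) := fun b => (tourEdges pad b).image (Sym2.map eqv)
  let v : Finset (Fin n) → (⊤ : SimpleGraph (Fin N)).edgeSet → ℝ := fun b => charVec (Tb b)
  -- evaluation of `c a` on the characteristic vector of a tour of `K_N`
  have heval : ∀ (a : Finset (Fin n)) (F : Finset (Sym2 (Fin N))), IsTourEdgeSet F →
      c a ⬝ᵥ charVec F = ∑ e ∈ F.image (Sym2.map eqv.symm), coeff a e := by
    intro a F hF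
    have hF' : IsTourOn F := hF
    have h1 := dotProduct_charVec (fun x => coeff a (Sym2.map eqv.symm x)) F
      (fun x hx => hF'.mem_edgeSet hx)
    rw [Finset.sum_image fun x _ y _ hxy => Sym2.map.injective eqv.symm.injective hxy]
    exact h1
  -- points
  have hv : ∀ b, v b ∈ tspPolytope N := fun b =>
    charVec_mem_tspPolytope ((isTourOn_tourEdges (pad := pad) b hn).image_equiv eqv)
  -- validity on all of `TSP(N)`
  have hvalid : ∀ a, ∀ x ∈ tspPolytope N, c a ⬝ᵥ x ≤ rhs a := by
    intro a x hx
    have hconv : Convex ℝ {y : (⊤ : SimpleGraph (Fin N)).edgeSet → ℝ | c a ⬝ᵥ y ≤ rhs a} := by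
      refine convex_halfSpace_le ⟨fun y z => dotProduct_add _ _ _, fun t y => ?_⟩ (rhs a)
      rw [dotProduct_smul, smul_eq_mul]
    refine (convexHull_min ?_ hconv) hx
    rintro y ⟨F, hF, rfl⟩
    show c a ⬝ᵥ charVec F ≤ rhs a
    rw [heval a F hF]
    exact sum_coeff_le ((isTourOn_iff_isTourEdgeSet F).2 hF |>.image_equiv eqv.symm) a
  -- value at the designated tours
  have himg : ∀ b, (Tb b).image (Sym2.map eqv.symm) = tourEdges pad b := by
    intro b
    simp only [Tb, Finset.image_image]
    have hcomp : (Sym2.map eqv.symm ∘ Sym2.map eqv : Sym2 (GV n pad) → Sym2 (GV n pad)) = id := by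
      funext e
      induction e using Sym2.ind with
      | h x y => simp
    rw [hcomp, Finset.image_id]
  have hval : ∀ a b, c a ⬝ᵥ v b = rhs a - ((a ∩ b).card - 1 : ℝ) ^ 2 := by
    intro a b
    show c a ⬝ᵥ charVec (Tb b) = _
    rw [heval a (Tb b) ((isTourOn_tourEdges (pad := pad) b hn).image_equiv eqv), himg,
      sum_coeff_tourEdges hn]
  -- conclude
  refine h.three_pow_le v hv c rhs hvalid (fun a b hab => ?_) (fun a b hab => ?_)
  · rw [hval] at hab
    intro h1
    rw [h1] at hab
    norm_num at hab
  · rw [hval, Finset.disjoint_iff_inter_eq_empty.1 hab, Finset.card_empty]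
    norm_num

/-! ### Step 3: asymptotics -/

/-- Real-analysis core of the asymptotics: for `N ≥ 900` and `n = ⌊√N⌋ / 5`,
`(3/2)^{√N/10} + 1 ≤ (3/2)^n`. [folklore] -/
theorem rpow_sqrt_le_pow (N : ℕ) (hN : 900 ≤ N) :
    (3 / 2 : ℝ) ^ (Real.sqrt N / 10) + 1 ≤ (3 / 2 : ℝ) ^ (Nat.sqrt N / 5) := by
  set n := Nat.sqrt N / 5 with hn
  -- `n ≥ √N/5 - 2`
  have hsqrt : Real.sqrt N < Nat.sqrt N + 1 := by
    have h1 : (N : ℝ) < ((Nat.sqrt N + 1 : ℕ) : ℝ) ^ 2 := by exact_mod_cast Nat.lt_succ_sqrt' N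
    have h2 : Real.sqrt N < Real.sqrt (((Nat.sqrt N + 1 : ℕ) : ℝ) ^ 2) :=
      Real.sqrt_lt_sqrt (Nat.cast_nonneg N) h1
    rw [Real.sqrt_sq (by positivity)] at h2
    push_cast at h2
    exact h2
  have hdiv : Nat.sqrt N < 5 * (n + 1) := by
    rw [hn]
    omega
  have hnge : Real.sqrt N / 5 - 2 ≤ n := by
    have : (Nat.sqrt N : ℝ) < 5 * (n + 1) := by exact_mod_cast hdiv
    linarith
  -- `y := (3/2)^{√N/10} ≥ 3`
  set y := (3 / 2 : ℝ) ^ (Real.sqrt N / 10) with hy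
  have hsqrtN : (30 : ℝ) ≤ Real.sqrt N := by
    rw [show (30 : ℝ) = Real.sqrt 900 by rw [show (900 : ℝ) = 30 ^ 2 by norm_num, Real.sqrt_sq (by norm_num)]]
    exact Real.sqrt_le_sqrt (by exact_mod_cast hN)
  have hy3 : 3 ≤ y := by
    have h1 : (3 : ℝ) ≤ (3 / 2 : ℝ) ^ (3 : ℝ) := by norm_num
    refine h1.trans ?_
    exact Real.rpow_le_rpow_of_exponent_le (by norm_num) (by linarith)
  -- `(3/2)^n ≥ (3/2)^{√N/5 - 2} = (4/9) y²`
  have hpow : (3 / 2 : ℝ) ^ (Real.sqrt N / 5 - 2) ≤ (3 / 2 : ℝ) ^ n := by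
    rw [← Real.rpow_natCast]
    exact Real.rpow_le_rpow_of_exponent_le (by norm_num) hnge
  have hsplit : (3 / 2 : ℝ) ^ (Real.sqrt N / 5 - 2) = (4 / 9) * y ^ 2 := by
    rw [Real.rpow_sub (by norm_num), show Real.sqrt N / 5 = Real.sqrt N / 10 * 2 by ring,
      Real.rpow_mul (by norm_num), hy]
    norm_num
    ring
  rw [hsplit] at hpow
  nlinarith [hy3, hpow]

/-- **FMPTW Theorem 12, asymptotic form**: there is `c > 0` (namely `log(3/2) / (10 log 2)`)
such that for all `N ≥ 900` every extended formulation of `TSP(N)` has at least `2^{c√N}`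
inequalities. [cite: FioriniEtAl2015, Thm. 12 (PDF p. 11)] -/
theorem two_rpow_sqrt_le_of_hasEF (N : ℕ) (hN : 900 ≤ N) (r : ℕ)
    (h : HasEFOfSize (tspPolytope N) r) :
    (2 : ℝ) ^ (Real.log (3 / 2) / (10 * Real.log 2) * Real.sqrt N) ≤ r := by
  -- choose `n`, `pad`
  set n := Nat.sqrt N / 5 with hn
  have hsq : Nat.sqrt N * Nat.sqrt N ≤ N := Nat.sqrt_le N
  have hn5 : 5 * n ≤ Nat.sqrt N := by rw [hn]; omega
  have hle : 15 * n ^ 2 + 2 * n ≤ N := by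
    have : 25 * n ^ 2 ≤ N := by nlinarith
    nlinarith
  have hn0 : 0 < n := by
    rw [hn]
    have : 30 ≤ Nat.sqrt N := by
      rw [Nat.le_sqrt]
      omega
    omega
  obtain ⟨pad, hpad⟩ : ∃ pad, N = 15 * n ^ 2 + 2 * n + pad := ⟨N - (15 * n ^ 2 + 2 * n), by omega⟩
  -- the combinatorial bound
  have hcomb : 3 ^ n ≤ (r + 1) * 2 ^ n := by
    rw [hpad] at h
    exact three_pow_le_of_hasEF hn0 h
  -- as reals: `(3/2)^n ≤ r + 1`
  have hreal : (3 / 2 : ℝ) ^ n ≤ r + 1 := by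
    have h1 : ((3 ^ n : ℕ) : ℝ) ≤ (((r + 1) * 2 ^ n : ℕ) : ℝ) := by exact_mod_cast hcomb
    push_cast at h1
    rw [div_pow, div_le_iff₀ (by positivity)]
    linarith
  have key := rpow_sqrt_le_pow N hN
  -- `2^{c√N} = (3/2)^{√N/10}`
  have hexp : (2 : ℝ) ^ (Real.log (3 / 2) / (10 * Real.log 2) * Real.sqrt N) =
      (3 / 2 : ℝ) ^ (Real.sqrt N / 10) := by
    rw [Real.rpow_def_of_pos (by norm_num), Real.rpow_def_of_pos (by norm_num)]
    congr 1
    have hlog2 : Real.log 2 ≠ 0 := Real.log_ne_zero_of_pos_of_ne_one (by norm_num) (by norm_num)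
    field_simp
  rw [hexp]
  linarith

/-- **Discharge of the barrier fact** `TSPExtensionComplexity` (FMPTW 2015, Thm. 12: "The
extension complexity of the TSP polytope `TSP(n)` is `2^{Ω(n^{1/2})}`"), with the explicit
constant `c = log(3/2) / (10 log 2)` and threshold `n ≥ 900`.
[cite: FioriniEtAl2015, Thm. 12 (PDF p. 11)] -/
theorem TSPExtensionComplexity_holds : TSPExtensionComplexity := by
  refine ⟨Real.log (3 / 2) / (10 * Real.log 2), ?_, ?_⟩
  · have h1 : 0 < Real.log (3 / 2) := Real.log_pos (by norm_num)
    have h2 : 0 < Real.log 2 := Real.log_pos (by norm_num)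
    positivity
  · filter_upwards [eventually_ge_atTop 900] with N hN r hr
    exact two_rpow_sqrt_le_of_hasEF N hN r hr

end Literature.Barriers.PneNP

end
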